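import Summits.MatrixMultiplication.MatrixMultiplication.Theorems.ObstructionDescentLeviWeylLaw
import Literature.Computability.AlgebraicComplexity.BI17FundamentalInvariantTensors

set_option linter.dupNamespace false

/-!
# Odd levels vanish at the unit tensor: the period-two law in kernel (decomp-mm · lens 3 · gen 13, part 2)

Route `route-MatrixMultiplication-ObstructionDescent`, support for the aside `InvariantSaturation` (item
`stmt-MatrixMultiplication-32282`); continues `ObstructionDescentLeviWeylLaw` (odd-symmetry vanishing).

The padded unit tensor `⟨N⟩ = padUnitLast m N` (the witness point of hypothesis (U) of the invariant tower,
`ObstructionDescentInvariantTower`) is fixed by every simultaneous relabelling of the corner indices; a transposition of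
two corner indices is ODD.  Hence, by the Levi–Weyl sign law, every weight vector of an odd rectangular level vanishes at
`⟨N⟩`: for `N ≥ 2` the levels of the point `⟨N⟩` are all EVEN (`pointLevels_padUnitLast_subset_even`).  This is the
kernel form of «the unit tensor has period 2» (Bürgisser–Ikenmeyer 2017 = arXiv:1511.02927, Thm 4.3: `Stab⟨m⟩ = T_m ⋊ S_m`,
stabiliser period `2`; Thm 5.3: `E(w) ⊆ m·a(w)·ℤ`, so `E(⟨m⟩) ⊆ 2mℕ`), read on rectangular weight vectors, and it
certifies that the shape of hypothesis (U) in `tower_of_levels` / `unitLevels_of_prim` — EVEN levels `≥ n` only — is the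
maximal one: no odd level can ever be witnessed at `⟨n²⟩`, so odd levels need the other witness points (secant points
`ObstructionDescentSecantLevels`, corner equations) exactly as the tower is organised.
All hypotheses inline; no proposition defined; no `sorry`; standard axioms.  Nothing here proves `ω = 2`.
[cite: BurgisserIkenmeyer2017, Thm 4.3, Def. 5.2, Thm 5.3 (arXiv numbering); BurgisserIkenmeyer2011, Lemma 3.2]
-/

noncomputable section

open scoped BigOperators
open Finset

namespace Summit.MatrixMultiplication.MatrixMultiplication.Theorems.ObstructionCalculus

open Literature.Computability.AlgebraicComplexity (actTensor actTensor_actTensor actTensor_permMatrix_apply triad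
  triad_apply unitTensor)

section UnitParity

variable {m : ℕ}

/-! ### 1 · Period two of the padded unit tensor `⟨N⟩` -/

/-- Entries of the padded unit tensor: `⟨N⟩_{abc} = [a = b = c in the corner]`. [bookkeeping] -/
theorem padUnitLast_apply (N : ℕ) (a b c : Fin m) :
    padUnitLast m N a b c = if a = b ∧ b = c ∧ m ≤ (a : ℕ) + N then 1 else 0 := by
  simp only [padUnitLast, fromCols, lastProj, Finset.sum_apply, triad_apply, Matrix.diagonal_apply]
  rw [Finset.sum_eq_single a]
  · by_cases hab : a = b
    · subst hab
      by_cases hac : a = c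
      · subst hac
        by_cases hN : m ≤ (a : ℕ) + N <;> simp [hN]
      · simp [hac, Ne.symm hac]
    · simp [hab, Ne.symm hab]
  · intro l _ hl
    simp [Ne.symm hl]
  · simp

/-- A simultaneous relabelling by a permutation moving only corner indices fixes `⟨N⟩`. [this node] -/
theorem actTensor_permMatrix_padUnitLast (N : ℕ) (σ : Equiv.Perm (Fin m))
    (hσ : ∀ a, σ a ≠ a → m ≤ (a : ℕ) + N) :
    actTensor (σ.permMatrix ℂ) (σ.permMatrix ℂ) (σ.permMatrix ℂ) (padUnitLast m N) = padUnitLast m N := by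
  funext a b c
  rw [actTensor_permMatrix_apply, padUnitLast_apply, padUnitLast_apply]
  have hc : (m ≤ ((σ a : Fin m) : ℕ) + N ↔ m ≤ (a : ℕ) + N) := by
    by_cases h : σ a = a
    · rw [h]
    · refine iff_of_true (hσ (σ a) fun h' => h (σ.injective h')) (hσ a h)
  simp only [EmbeddingLike.apply_eq_iff_eq, hc]

/-- **Period two of the unit tensor (kernel): an ODD level is never a level of the point `⟨N⟩`** — the transposition
of two corner indices `i ≠ j` is an odd symmetry of `⟨N⟩`, so every weight vector of odd rectangular level `k` vanishes
there (`not_mem_pointLevels_of_oddSymmetry`). [cite: BurgisserIkenmeyer2017, Thm 4.3, Thm 5.3] -/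
theorem not_mem_pointLevels_padUnitLast_of_odd {N k : ℕ} (hk : Odd k) {i j : Fin m} (hij : i ≠ j)
    (hi : m ≤ (i : ℕ) + N) (hj : m ≤ (j : ℕ) + N) : k ∉ pointLevels N (padUnitLast m N) := by
  have hσ : ∀ a, Equiv.swap i j a ≠ a → m ≤ (a : ℕ) + N := by
    intro a ha
    by_cases hai : a = i
    · exact hai ▸ hi
    by_cases haj : a = j
    · exact haj ▸ hj
    · exact absurd (Equiv.swap_apply_of_ne_of_ne hai haj) ha
  exact not_mem_pointLevels_of_oddSymmetry hk (Equiv.swap i j) hσ (Equiv.Perm.sign_swap hij)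
    (actTensor_permMatrix_padUnitLast N _ hσ)

/-- The same with the two corner indices `m − 1`, `m − 2` supplied: for `2 ≤ N ≤ m`, odd `k ∉ E'(⟨N⟩)`. [this node] -/
theorem not_mem_pointLevels_padUnitLast_of_odd' {N k : ℕ} (hk : Odd k) (h2 : 2 ≤ N) (hN : N ≤ m) :
    k ∉ pointLevels N (padUnitLast m N) :=
  not_mem_pointLevels_padUnitLast_of_odd hk (i := ⟨m - 1, by omega⟩) (j := ⟨m - 2, by omega⟩)
    (fun h => by
      have h' := congrArg Fin.val h
      simp only at h'
      omega)
    (by simp only; omega) (by simp only; omega)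

/-- **The levels of `⟨N⟩` are even** (`N ≥ 2`): `E'(⟨N⟩) ⊆ 2ℕ` — hypothesis (U) of the tower (even levels `≥ n` at
`⟨n²⟩`) has the only possible shape. [cite: BurgisserIkenmeyer2017, Thm 4.3, Thm 5.3] -/
theorem pointLevels_padUnitLast_subset_even {N : ℕ} (h2 : 2 ≤ N) (hN : N ≤ m) :
    pointLevels N (padUnitLast m N) ⊆ {k | Even k} := fun k hk =>
  (Nat.even_or_odd k).resolve_right fun ho => not_mem_pointLevels_padUnitLast_of_odd' ho h2 hN hk

/-- Square-format reading for the tower cell `(n, m)`, `n ≥ 2`, `n² ≤ m`: every level of the point `⟨n²⟩` is even.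
[this node] -/
theorem unitLevels_even {n : ℕ} (hn : 2 ≤ n) (hm : n * n ≤ m) {k : ℕ}
    (hk : k ∈ pointLevels (n * n) (padUnitLast m (n * n))) : Even k :=
  pointLevels_padUnitLast_subset_even (le_trans hn (Nat.le_mul_self n)) hm hk

/-! ### 2 · The first cell `m = N`: full `GL_m³`-invariance of the level set, and `E(⟨m⟩) ⊆ 2mℕ` -/

/-- At format `N = m` (the whole cube is the corner) the level set of a point is invariant under EVERY invertible
one-slot substitution: `GL_m` is generated by invertible diagonal matrices (Borel moves) and transvections (Levi–Weyl
law (A), both blocks trivial), Mathlib's `Matrix.diagonal_transvection_induction_of_det_ne_zero`. [this node] -/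
theorem pointLevels_self_slotAct (s : Fin 3) {g : Matrix (Fin m) (Fin m) ℂ} (hg : g.det ≠ 0) (t : Tensor ℂ m) :
    pointLevels m (slotAct s g t) = pointLevels m t := by
  revert t
  refine Matrix.diagonal_transvection_induction_of_det_ne_zero
    (fun g => ∀ t, pointLevels m (slotAct s g t) = pointLevels m t) g hg ?_ ?_ ?_
  · intro D hD t
    refine pointLevels_slotAct_borel m s (diagonal_mem_borel fun i => ?_) t
    rw [Matrix.det_diagonal] at hD
    exact Finset.prod_ne_zero_iff.1 hD i (Finset.mem_univ i)
  · intro τ t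
    exact pointLevels_slotAct_transvection m s τ.hij
      (iff_of_true (Nat.le_add_left m _) (Nat.le_add_left m _)) τ.c t
  · intro A B _ _ hA hB t
    rw [← slotAct_mul A B t s, hA, hB]

/-- Hence at the first cell the level set is invariant under all of `GL_m³`. [this node] -/
theorem pointLevels_self_actTensor {A B C : Matrix (Fin m) (Fin m) ℂ} (hA : A.det ≠ 0) (hB : B.det ≠ 0)
    (hC : C.det ≠ 0) (t : Tensor ℂ m) : pointLevels m (actTensor A B C t) = pointLevels m t := by
  have h : actTensor A B C t = slotAct 0 A (slotAct 1 B (slotAct 2 C t)) := by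
    simp only [slotAct_zero, slotAct_one, slotAct_two, actTensor_actTensor, Matrix.mul_one, Matrix.one_mul]
  rw [h, pointLevels_self_slotAct 0 hA, pointLevels_self_slotAct 1 hB, pointLevels_self_slotAct 2 hC]

/-- `padUnitLast m m = ⟨m⟩` (at `N = m` the corner projection is the identity). [bookkeeping] -/
theorem padUnitLast_self : padUnitLast m m = unitTensor ℂ m := by
  have h : lastProj m m = 1 := by
    ext i j
    by_cases hij : i = j
    · subst hij; simp [lastProj]
    · simp [lastProj, hij]
  rw [padUnitLast, h, unitTensor_eq_fromCols]

/-- **`E(⟨m⟩) ⊆ 2m·ℕ` as a tree theorem: at the first cell `m = N ≥ 2` of the invariant tower NO ODD LEVEL PASSES.**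
A level `k` passes at `(m, N) = (m, m)` iff some weight vector of type `((k^m))³` — an `SL_m³`-invariant of degree
`km` — is non-zero somewhere on `GL_m³·⟨m⟩`; by `GL_m³`-invariance of level sets that means non-zero AT `⟨m⟩`, which
period two forbids for odd `k`.  This is Bürgisser–Ikenmeyer's `E(w) ⊆ m·a(w)·ℤ` (Thm 5.3) with `a(⟨m⟩) = 2` (Thm 4.3)
for `w = ⟨m⟩`, now kernel-checked at the tree's definitions; with a non-empty odd level `k ≥ 2` (e.g. `k_4(3) = k_9(3)
= 1`, `k_{n²}(n) = 1` for odd `n`) it re-derives that the cell statement of `InvariantSaturation` is false AT `m = n²`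
(gen 11, H9) for a structural reason. [cite: BurgisserIkenmeyer2017, Thm 4.3, Thm 5.3] -/
theorem passLevels_self_subset_even (hm : 2 ≤ m) : passLevels m m ⊆ {k | Even k} := by
  intro k hk
  refine (Nat.even_or_odd k).resolve_right fun ho => hk fun f hf A B C hA hB hC => ?_
  by_contra hne
  have hmem : k ∈ pointLevels m (actTensor A B C (unitTensor ℂ m)) := ⟨f, hf, hne⟩
  rw [pointLevels_self_actTensor hA hB hC, ← padUnitLast_self] at hmem
  exact not_mem_pointLevels_padUnitLast_of_odd' ho hm le_rfl hmem

/-- Equivalently: an odd level that passes at the first cell is a contradiction — odd levels climb the tower only from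
cells `m > N`, through witness points that are NOT `GL³`-translates of `⟨N⟩` (secant points, corner equations). [this node] -/
theorem not_mem_passLevels_self_of_odd (hm : 2 ≤ m) {k : ℕ} (hk : Odd k) : k ∉ passLevels m m :=
  fun h => (Nat.not_even_iff_odd.2 hk) (passLevels_self_subset_even hm h)

end UnitParity

end Summit.MatrixMultiplication.MatrixMultiplication.Theorems.ObstructionCalculus
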